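import Summits.AtomisticToContinuum.Crystallization.Theorems.FrustratedLawDichotomyTwoShellRigidityFrames

/-!
# FrustratedLawDichotomy · two-shell rigidity — GLUING two cell isometries across a shared edge (toolkit for `FrameAssembly`)

Theses-free toolkit (pure Mathlib) for the last piece `FrameAssemblyAt K c` of lens-5's split of `R = CoarseCappedRigidity`
(`FrustratedLawDichotomyTwoShellRigidityCells`; `Extraction` p820807, `TetraCellAt 11` p821511, `OctaCellAt 18` are proved).  The frame
assembly glues the fourteen cell isometries along shared edges; the analytic step is: two linear isometries `A₁, A₂` of a
three-dimensional real inner product space that agree up to `η` on two unit anchors `z₀, z₁` at angle `60°` or `90°`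
(`⟪z₀, z₁⟫² ≤ 1/4`) agree up to `3η` on the unit normal `n` of the anchors — OR differ there by the reflection in the anchor plane
(`isometry_transfer_two_anchors`: `‖A₂ n − A₁ n‖ ≤ 3η ∨ ‖A₂ n + A₁ n‖ ≤ 3η`, for `η ≤ 1/2`); consequently every `x = p z₀ + q z₁ + r n`
is carried by `A₂` to within `(|p| + |q| + 3|r|)·η` of `A₁ x` or of `A₁ (x − 2r·n)` (`isometry_transfer_point`).  The mirror branch is
what the non-contact clause of `FrameAssemblyAt` excludes in the pattern walk (reflected vertex `0.577·d` from, or on, a placed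
non-contact).  Also `frame_expansion` (coordinates in an orthonormal frame, dimension three).  No `sorry`, no defs.
-/

noncomputable section

namespace Summit.AtomisticToContinuum.Crystallization.Theorems.FrustratedLawDichotomyTwoShellRigidityGluing

open Summit.AtomisticToContinuum.Crystallization.Theorems.FrustratedLawDichotomyTwoShellRigidityFrames
open scoped RealInnerProductSpace

variable {V : Type*} [NormedAddCommGroup V] [InnerProductSpace ℝ V]

/-- Expansion of any vector in an orthonormal frame (dimension three): `x = ⟪x,f₀⟫f₀ + ⟪x,f₁⟫f₁ + ⟪x,f₂⟫f₂`. [folklore] -/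
theorem frame_expansion [FiniteDimensional ℝ V] (hV : Module.finrank ℝ V = 3) {f₀ f₁ f₂ : V} (h0 : ‖f₀‖ = 1) (h1 : ‖f₁‖ = 1)
    (h2 : ‖f₂‖ = 1) (h01 : ⟪f₀, f₁⟫ = 0) (h02 : ⟪f₀, f₂⟫ = 0) (h12 : ⟪f₁, f₂⟫ = 0) (x : V) :
    x = ⟪x, f₀⟫ • f₀ + ⟪x, f₁⟫ • f₁ + ⟪x, f₂⟫ • f₂ := by
  classical
  have h10 : ⟪f₁, f₀⟫ = 0 := by rw [real_inner_comm, h01]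
  have h20 : ⟪f₂, f₀⟫ = 0 := by rw [real_inner_comm, h02]
  have h21 : ⟪f₂, f₁⟫ = 0 := by rw [real_inner_comm, h12]
  have hon : Orthonormal ℝ ![f₀, f₁, f₂] := by
    rw [orthonormal_iff_ite]
    intro i j
    fin_cases i <;> fin_cases j <;> simp [h0, h1, h2, h01, h02, h12, h10, h20, h21]
  have hcard : Fintype.card (Fin 3) = Module.finrank ℝ V := by rw [Fintype.card_fin, hV]
  let b : OrthonormalBasis (Fin 3) ℝ V := OrthonormalBasis.mk hon
    (by rw [hon.linearIndependent.span_eq_top_of_card_eq_finrank hcard])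
  have hb : ∀ k, b k = ![f₀, f₁, f₂] k := fun k => by rw [OrthonormalBasis.coe_mk]
  have hx := b.sum_repr' x
  rw [Fin.sum_univ_three, hb, hb, hb] at hx
  simp only [Matrix.cons_val_zero, Matrix.cons_val_one, Matrix.cons_val] at hx
  rw [← real_inner_comm f₀ x, ← real_inner_comm f₁ x, ← real_inner_comm f₂ x] at hx
  exact hx.symm

/-- `|⟪y, v⟫| ≤ η` when `‖y‖ = 1` and `‖v‖ ≤ η`. [folklore] -/
theorem abs_inner_le_of_unit {y v : V} (hy : ‖y‖ = 1) {η : ℝ} (hv : ‖v‖ ≤ η) : -η ≤ ⟪y, v⟫ ∧ ⟪y, v⟫ ≤ η := by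
  have h := abs_real_inner_le_norm y v
  rw [hy, one_mul] at h
  constructor
  · linarith [(abs_le.1 (h.trans hv)).1]
  · linarith [(abs_le.1 (h.trans hv)).2]

/-- **Gluing two isometries across a shared edge.**  `A₁, A₂` linear isometries of a three-dimensional real inner product space,
`z₀, z₁` unit anchors with `⟪z₀, z₁⟫² ≤ 1/4`, `n` a unit normal of both, `‖A₁ zᵢ − A₂ zᵢ‖ ≤ η ≤ 1/2` ⟹
`‖A₂ n − A₁ n‖ ≤ 3η` (same orientation) or `‖A₂ n + A₁ n‖ ≤ 3η` (mirror across the anchor plane). [folklore] -/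
theorem isometry_transfer_two_anchors [FiniteDimensional ℝ V] (hV : Module.finrank ℝ V = 3) (A₁ A₂ : V →ₗᵢ[ℝ] V)
    {z₀ z₁ n : V} (hz0 : ‖z₀‖ = 1) (hz1 : ‖z₁‖ = 1) (hκ : ⟪z₀, z₁⟫ ^ 2 ≤ 1 / 4) (hn : ‖n‖ = 1) (hn0 : ⟪z₀, n⟫ = 0)
    (hn1 : ⟪z₁, n⟫ = 0) {η : ℝ} (hη : η ≤ 1 / 2) (h0 : ‖A₁ z₀ - A₂ z₀‖ ≤ η) (h1 : ‖A₁ z₁ - A₂ z₁‖ ≤ η) :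
    ‖A₂ n - A₁ n‖ ≤ 3 * η ∨ ‖A₂ n + A₁ n‖ ≤ 3 * η := by
  have hη0 : 0 ≤ η := (norm_nonneg _).trans h0
  -- Gram–Schmidt of the anchors: `z₀ = e₀`, `z₁ = κ e₀ + γ e₁`, `n = e₂`
  obtain ⟨e₀, e₁, e₂, κ, γ, δ, ε, ζ, he0, he1, he2, he01, he02, he12, r0, r1, r2, hγ, hζ⟩ := gramSchmidt_triple hV z₀ z₁ n
  have hE := inner_frame he0 he1 he2 he01 he02 he12
  have hEn := norm_sq_frame he0 he1 he2 he01 he02 he12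
  rw [hz0, one_smul] at r0
  have z03 : z₀ = (1 : ℝ) • e₀ + (0 : ℝ) • e₁ + (0 : ℝ) • e₂ := by rw [r0]; module
  have z13 : z₁ = κ • e₀ + γ • e₁ + (0 : ℝ) • e₂ := by rw [r1]; module
  have q1 : ⟪z₀, z₁⟫ = κ := by
    have h := hE 1 0 0 κ γ 0
    rw [← z03, ← z13] at h
    linarith only [h]
  have q2 : κ ^ 2 + γ ^ 2 = 1 := by
    have h := hEn κ γ 0
    rw [← z13, hz1] at h
    linarith only [h]
  have q3 : δ = 0 := by
    have h := hE 1 0 0 δ ε ζ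
    rw [← z03, ← r2, hn0] at h
    linarith only [h]
  have hγ1 : 866 / 1000 ≤ γ := by
    rw [q1] at hκ
    exact le_of_sq_le_sq_nonneg hγ (by norm_num) (by norm_num; linarith only [q2, hκ])
  have q4 : ε = 0 := by
    have h := hE κ γ 0 δ ε ζ
    rw [← z13, ← r2, hn1, q3] at h
    have : γ * ε = 0 := by linarith only [h]
    rcases mul_eq_zero.1 this with h' | h'
    · exact absurd h' (by linarith only [hγ1])
    · exact h'
  have q5 : ζ = 1 := by
    have h := hEn δ ε ζ
    rw [← r2, hn, q3, q4] at h
    have h2 : ζ ^ 2 = 1 ^ 2 := by linarith only [h]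
    exact (sq_eq_sq₀ hζ zero_le_one).1 h2
  rw [q3, q4, q5, zero_smul, zero_smul, zero_add, zero_add, one_smul] at r2
  -- the image frame under `A₁`
  have hf0 : ‖A₁ e₀‖ = 1 := by rw [A₁.norm_map, he0]
  have hf1 : ‖A₁ e₁‖ = 1 := by rw [A₁.norm_map, he1]
  have hf2 : ‖A₁ e₂‖ = 1 := by rw [A₁.norm_map, he2]
  have hf01 : ⟪A₁ e₀, A₁ e₁⟫ = 0 := by rw [A₁.inner_map_map, he01]
  have hf02 : ⟪A₁ e₀, A₁ e₂⟫ = 0 := by rw [A₁.inner_map_map, he02]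
  have hf12 : ⟪A₁ e₁, A₁ e₂⟫ = 0 := by rw [A₁.inner_map_map, he12]
  have hFn := norm_sq_frame hf0 hf1 hf2 hf01 hf02 hf12
  -- coordinates of `y = A₂ n`
  have hy : ‖A₂ n‖ = 1 := by rw [A₂.norm_map, hn]
  obtain ⟨a, ha⟩ : ∃ a : ℝ, ⟪A₂ n, A₁ e₀⟫ = a := ⟨_, rfl⟩
  obtain ⟨b, hb⟩ : ∃ b : ℝ, ⟪A₂ n, A₁ e₁⟫ = b := ⟨_, rfl⟩
  obtain ⟨c, hc⟩ : ∃ c : ℝ, ⟪A₂ n, A₁ e₂⟫ = c := ⟨_, rfl⟩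
  have hexp := frame_expansion hV hf0 hf1 hf2 hf01 hf02 hf12 (A₂ n)
  rw [ha, hb, hc] at hexp
  -- `a` and `⟪A₂ n, A₁ z₁⟫` are small
  have hort0 : ⟪A₂ n, A₂ z₀⟫ = 0 := by rw [A₂.inner_map_map, real_inner_comm, hn0]
  have hort1 : ⟪A₂ n, A₂ z₁⟫ = 0 := by rw [A₂.inner_map_map, real_inner_comm, hn1]
  have ha1 : -η ≤ a ∧ a ≤ η := by
    have h := abs_inner_le_of_unit hy h0
    rw [inner_sub_right, hort0, sub_zero, r0, ha] at h
    exact h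
  have hw1 : -η ≤ ⟪A₂ n, A₁ z₁⟫ ∧ ⟪A₂ n, A₁ z₁⟫ ≤ η := by
    have h := abs_inner_le_of_unit hy h1
    rw [inner_sub_right, hort1, sub_zero] at h
    exact h
  have hlin : ⟪A₂ n, A₁ z₁⟫ = κ * a + γ * b := by
    rw [r1, map_add, map_smul, map_smul, inner_add_right, real_inner_smul_right, real_inner_smul_right, ha, hb]
  have hκ1 : -(1 / 2) ≤ κ ∧ κ ≤ 1 / 2 := by
    rw [q1] at hκ
    constructor <;> nlinarith only [hκ]
  obtain ⟨hka1, hka2⟩ := (show -(1 / 2 * η) ≤ κ * a ∧ κ * a ≤ 1 / 2 * η from by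
    obtain ⟨l, r⟩ := Summit.AtomisticToContinuum.Crystallization.Theorems.FrustratedLawDichotomyTwoShellRigidityFrames.mul_window
      (show (0 : ℝ) ≤ |κ| from abs_nonneg κ) (abs_le.2 hκ1) ha1.1 ha1.2
    rcases le_or_gt 0 κ with hk | hk
    · rw [abs_of_nonneg hk] at l r; exact ⟨l, r⟩
    · rw [abs_of_neg hk] at l r; constructor <;> linarith only [l, r])
  have hb1 : -(174 / 100 * η) ≤ b ∧ b ≤ 174 / 100 * η := by
    have hgb1 : -(3 / 2 * η) ≤ γ * b := by linarith only [hw1.1, hlin, hka2]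
    have hgb2 : γ * b ≤ 3 / 2 * η := by linarith only [hw1.2, hlin, hka1]
    constructor
    · by_contra H
      push Not at H
      have : γ * b < 866 / 1000 * (-(174 / 100 * η)) := by nlinarith only [H, hγ1, hη0]
      linarith only [this, hgb1, hη0]
    · by_contra H
      push Not at H
      have : 866 / 1000 * (174 / 100 * η) < γ * b := by nlinarith only [H, hγ1, hη0]
      linarith only [this, hgb2, hη0]
  -- `c² = 1 - a² - b²`
  have hsum : a ^ 2 + b ^ 2 + c ^ 2 = 1 := by
    have h := hFn a b c
    rw [← hexp, hy] at h
    linarith only [h]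
  have hasq : a ^ 2 ≤ η ^ 2 := sq_le_sq' ha1.1 ha1.2
  have hbsq : b ^ 2 ≤ (174 / 100 * η) ^ 2 := sq_le_sq' hb1.1 hb1.2
  have hsmall : a ^ 2 + b ^ 2 ≤ 41 / 10 * η ^ 2 := by linarith only [hasq, hbsq, sq_nonneg η]
  have hs0 : 0 ≤ a ^ 2 + b ^ 2 := by positivity
  have hss : (a ^ 2 + b ^ 2) ^ 2 ≤ (41 / 10 * η ^ 2) ^ 2 := pow_le_pow_left₀ hs0 hsmall 2
  have hη2 : η ^ 2 ≤ 1 / 4 := by nlinarith only [hη, hη0]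
  have hη4 : η ^ 2 * η ^ 2 ≤ 1 / 4 * η ^ 2 := mul_le_mul_of_nonneg_right hη2 (sq_nonneg η)
  have h3 : (0 : ℝ) ≤ 3 * η := by linarith only [hη0]
  rcases le_or_gt 0 c with hc0 | hc0
  · left
    have hc1 : c ≤ 1 := by nlinarith only [hsum, sq_nonneg a, sq_nonneg b, hc0]
    have hgap : (c - 1) ^ 2 ≤ (a ^ 2 + b ^ 2) ^ 2 := by nlinarith only [hsum, hc0, hc1]
    have hv : A₂ n - A₁ n = a • A₁ e₀ + b • A₁ e₁ + (c - 1) • A₁ e₂ := by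
      nth_rewrite 1 [hexp]; rw [r2]; module
    rw [hv]
    refine norm_frame_le hf0 hf1 hf2 hf01 hf02 hf12 h3 ?_
    linarith only [hsmall, hgap, hss, hη4, sq_nonneg η]
  · right
    have hc1 : -1 ≤ c := by nlinarith only [hsum, sq_nonneg a, sq_nonneg b, hc0]
    have hgap : (c + 1) ^ 2 ≤ (a ^ 2 + b ^ 2) ^ 2 := by nlinarith only [hsum, hc0, hc1]
    have hv : A₂ n + A₁ n = a • A₁ e₀ + b • A₁ e₁ + (c + 1) • A₁ e₂ := by
      nth_rewrite 1 [hexp]; rw [r2]; module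
    rw [hv]
    refine norm_frame_le hf0 hf1 hf2 hf01 hf02 hf12 h3 ?_
    linarith only [hsmall, hgap, hss, hη4, sq_nonneg η]

/-- **Transfer of a point across the glued edge.**  Under the hypotheses of `isometry_transfer_two_anchors`, a point
`x = p z₀ + q z₁ + r n` is carried by `A₂` to within `(|p| + |q| + 3|r|)·η` of `A₁ x` (same orientation) or of the mirror image
`A₁ (x − (2r) n)`. [folklore] -/
theorem isometry_transfer_point [FiniteDimensional ℝ V] (hV : Module.finrank ℝ V = 3) (A₁ A₂ : V →ₗᵢ[ℝ] V)
    {z₀ z₁ n : V} (hz0 : ‖z₀‖ = 1) (hz1 : ‖z₁‖ = 1) (hκ : ⟪z₀, z₁⟫ ^ 2 ≤ 1 / 4) (hn : ‖n‖ = 1) (hn0 : ⟪z₀, n⟫ = 0)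
    (hn1 : ⟪z₁, n⟫ = 0) {η : ℝ} (hη : η ≤ 1 / 2) (h0 : ‖A₁ z₀ - A₂ z₀‖ ≤ η) (h1 : ‖A₁ z₁ - A₂ z₁‖ ≤ η) (p q r : ℝ) :
    ‖A₂ (p • z₀ + q • z₁ + r • n) - A₁ (p • z₀ + q • z₁ + r • n)‖ ≤ (|p| + |q| + 3 * |r|) * η ∨
      ‖A₂ (p • z₀ + q • z₁ + r • n) - A₁ (p • z₀ + q • z₁ + r • n - (2 * r) • n)‖ ≤ (|p| + |q| + 3 * |r|) * η := by
  have hη0 : 0 ≤ η := (norm_nonneg _).trans h0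
  have e0 : ‖p • (A₂ z₀ - A₁ z₀)‖ ≤ |p| * η := by
    rw [norm_smul, Real.norm_eq_abs, ← norm_neg, neg_sub]; exact mul_le_mul_of_nonneg_left h0 (abs_nonneg p)
  have e1 : ‖q • (A₂ z₁ - A₁ z₁)‖ ≤ |q| * η := by
    rw [norm_smul, Real.norm_eq_abs, ← norm_neg, neg_sub]; exact mul_le_mul_of_nonneg_left h1 (abs_nonneg q)
  rcases isometry_transfer_two_anchors hV A₁ A₂ hz0 hz1 hκ hn hn0 hn1 hη h0 h1 with h | h
  · left
    have e2 : ‖r • (A₂ n - A₁ n)‖ ≤ |r| * (3 * η) := by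
      rw [norm_smul, Real.norm_eq_abs]; exact mul_le_mul_of_nonneg_left h (abs_nonneg r)
    have hv : A₂ (p • z₀ + q • z₁ + r • n) - A₁ (p • z₀ + q • z₁ + r • n) =
        p • (A₂ z₀ - A₁ z₀) + q • (A₂ z₁ - A₁ z₁) + r • (A₂ n - A₁ n) := by
      simp only [map_add, map_smul]; module
    rw [hv]
    calc ‖p • (A₂ z₀ - A₁ z₀) + q • (A₂ z₁ - A₁ z₁) + r • (A₂ n - A₁ n)‖
        ≤ ‖p • (A₂ z₀ - A₁ z₀)‖ + ‖q • (A₂ z₁ - A₁ z₁)‖ + ‖r • (A₂ n - A₁ n)‖ := norm_add₃_le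
      _ ≤ |p| * η + |q| * η + |r| * (3 * η) := by linarith [e0, e1, e2]
      _ = (|p| + |q| + 3 * |r|) * η := by ring
  · right
    have e2 : ‖r • (A₂ n + A₁ n)‖ ≤ |r| * (3 * η) := by
      rw [norm_smul, Real.norm_eq_abs]; exact mul_le_mul_of_nonneg_left h (abs_nonneg r)
    have hv : A₂ (p • z₀ + q • z₁ + r • n) - A₁ (p • z₀ + q • z₁ + r • n - (2 * r) • n) =
        p • (A₂ z₀ - A₁ z₀) + q • (A₂ z₁ - A₁ z₁) + r • (A₂ n + A₁ n) := by
      simp only [map_add, map_sub, map_smul]; module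
    rw [hv]
    calc ‖p • (A₂ z₀ - A₁ z₀) + q • (A₂ z₁ - A₁ z₁) + r • (A₂ n + A₁ n)‖
        ≤ ‖p • (A₂ z₀ - A₁ z₀)‖ + ‖q • (A₂ z₁ - A₁ z₁)‖ + ‖r • (A₂ n + A₁ n)‖ := norm_add₃_le
      _ ≤ |p| * η + |q| * η + |r| * (3 * η) := by linarith [e0, e1, e2]
      _ = (|p| + |q| + 3 * |r|) * η := by ring

end Summit.AtomisticToContinuum.Crystallization.Theorems.FrustratedLawDichotomyTwoShellRigidityGluing

end
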